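import Literature.Computability.Complexity.GateEliminationStanding
import Literature.Computability.Complexity.GateEliminationCase1

/-!
# Gate elimination: absorbing affine gates into the xor-part

Li–Yang §4.1 (before Case 6): "Let `G` be a topologically minimal ∧-type gate fed by `I₁` and
`I₂` … Clearly `I₁` and `I₂` are computed by a fair cyclic-xor circuit, hence we can perform
xor-reconstruction to them." In the formalization the cyclic xor-part `xorPart` is part of the
data of a semicircuit; a set `S` of ⊕-type gates closed under predecessors up to the xor-part can
be *absorbed* into it (`absorb`), changing nothing else: same gates, wires, functions, solutions,
fairness, out-degrees, troubled gates, packings, measure, and standing assumptions. In a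
non-degenerate circuit every gate with an affine function is ⊕-type
(`isXorOp_of_isAffineOp`), so the strict ancestors of a topologically minimal ∧-type gate can be
absorbed (`absorbAnc`), after which the gate reads only variables and gates of the xor-part.

## References

* J. Li, T. Yang, *3.1n − o(n) circuit lower bounds for explicit functions*, STOC 2022;
  ECCC TR21-023, Def. 2.5, §2.6, §4.1 (before Case 6).
-/

namespace Literature.Computability.Complexity

open Finset

namespace Semicircuit

variable {n : ℕ} (C : Semicircuit n)

/-- **In a non-degenerate circuit an affine gate is ⊕-type** (an affine function ignoring an
argument would make the gate depend on one wire only). [cite: LiYang2022, §2.1, §4.1 (Case 0.3)] -/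
theorem isXorOp_of_isAffineOp (hN : C.NonDegenerate) {k : Fin C.m} (haff : IsAffineOp (C.op k)) : IsXorOp (C.op k) := by
  obtain ⟨s₀, s₁, c, hop⟩ := haff
  cases s₀
  · exfalso
    refine hN k 1 ⟨fun q => (q && s₁) ^^ c, fun x w hw => ?_⟩
    rw [hw k, hop, Bool.and_false, Bool.false_xor]
  · cases s₁
    · exfalso
      refine hN k 0 ⟨fun p => p ^^ c, fun x w hw => ?_⟩
      rw [hw k, hop, Bool.and_false, Bool.and_true, Bool.xor_false]
    · exact ⟨c, fun a b => by rw [hop, Bool.and_true, Bool.and_true]⟩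

/-- **Absorbing a set of ⊕-type gates into the xor-part.** [cite: LiYang2022, Def. 2.5] -/
abbrev absorb (S : Finset (Fin C.m)) (hxor : ∀ k ∈ S, IsXorOp (C.op k))
    (hclosed : ∀ k ∈ S, ∀ (a : Fin 2) (k' : Fin C.m), C.arg k a = .gate k' → k' ∈ C.xorPart ∨ k' ∈ S) :
    Semicircuit n where
  m := C.m
  op := C.op
  arg := C.arg
  out := C.out
  xorPart := C.xorPart ∪ S
  isXorOp_of_mem k hk := by
    rcases mem_union.mp hk with hk | hk
    · exact C.isXorOp_of_mem k hk
    · exact hxor k hk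
  mem_of_arg_eq k hk a k' h := by
    rcases mem_union.mp hk with hk | hk
    · exact mem_union_left _ (C.mem_of_arg_eq k hk a k' h)
    · rcases hclosed k hk a k' h with h' | h'
      · exact mem_union_left _ h'
      · exact mem_union_right _ h'
  acyclic := by
    obtain ⟨ρ, hρ⟩ := C.acyclic
    refine ⟨ρ, fun k hk a k' h hk' => ?_⟩
    rw [mem_union, not_or] at hk hk'
    exact hρ k hk.1 a k' h hk'.1

section Absorb

variable (S : Finset (Fin C.m)) (hxor : ∀ k ∈ S, IsXorOp (C.op k))
  (hclosed : ∀ k ∈ S, ∀ (a : Fin 2) (k' : Fin C.m), C.arg k a = .gate k' → k' ∈ C.xorPart ∨ k' ∈ S)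

/-- Node values are unchanged. [folklore] -/
theorem nodeVal_absorb_eq (x : Fin n → Bool) (w : Fin C.m → Bool) (v : Node n C.m) :
    (C.absorb S hxor hclosed).nodeVal x w v = C.nodeVal x w v := by
  cases v <;> rfl

/-- Solutions are unchanged. [folklore] -/
theorem consistent_absorb_iff (x : Fin n → Bool) (w : Fin C.m → Bool) :
    (C.absorb S hxor hclosed).Consistent x w ↔ C.Consistent x w := by
  unfold Consistent
  simp only [nodeVal_absorb_eq]

/-- Fairness is unchanged. [folklore] -/
theorem fair_absorb_iff : (C.absorb S hxor hclosed).Fair ↔ C.Fair := by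
  unfold Fair
  simp only [consistent_absorb_iff]

/-- Computing `f|_R` is unchanged. [folklore] -/
theorem computesRestr_absorb_iff (f : (Fin n → ZMod 2) → Bool) (R : RdqSource n) :
    (C.absorb S hxor hclosed).ComputesRestr f R ↔ C.ComputesRestr f R := by
  unfold ComputesRestr
  simp only [consistent_absorb_iff, nodeVal_absorb_eq]
  exact Iff.rfl

/-- Pre-normalization is unchanged. [folklore] -/
theorem preNormalized_absorb_iff : (C.absorb S hxor hclosed).PreNormalized ↔ C.PreNormalized :=
  ⟨fun h => ⟨h.1, h.2, h.3⟩, fun h => ⟨h.1, h.2, h.3⟩⟩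

/-- Dependence on one wire is unchanged. [folklore] -/
theorem depOnlyOn_absorb_iff (k : Fin C.m) (a : Fin 2) : (C.absorb S hxor hclosed).DepOnlyOn k a ↔ C.DepOnlyOn k a := by
  unfold DepOnlyOn
  simp only [consistent_absorb_iff, nodeVal_absorb_eq]

/-- Out-degrees are unchanged. [folklore] -/
theorem fanout_absorb (v : Node n C.m) : (C.absorb S hxor hclosed).fanout v = C.fanout v := rfl

/-- Troubled gates are unchanged. [folklore] -/
theorem troubled_absorb_iff (k : Fin C.m) : (C.absorb S hxor hclosed).Troubled k ↔ C.Troubled k := Iff.rfl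

/-- Packings are unchanged. [folklore] -/
theorem isPacking_absorb_iff (P : Finset (Fin C.m × Fin C.m)) : (C.absorb S hxor hclosed).IsPacking P ↔ C.IsPacking P :=
  Iff.rfl

/-- The measure is unchanged. [folklore] -/
theorem measure_absorb (αφ αI αQ : ℝ) (P : Finset (Fin C.m × Fin C.m)) (R : RdqSource n) :
    (C.absorb S hxor hclosed).measure αφ αI αQ P R = C.measure αφ αI αQ P R := rfl

/-- The standing assumptions are unchanged (the only field mentioning the xor-part asks less).
[cite: LiYang2022, §4.1] -/
theorem standing_absorb {R : RdqSource n} (h : C.Standing R) : (C.absorb S hxor hclosed).Standing R :=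
  { normalized := ⟨(C.preNormalized_absorb_iff S hxor hclosed).mpr h.normalized.1, h.normalized.2⟩
    reachesOut := fun G hG => h.reachesOut G fun hGK => hG (mem_union_left _ hGK)
    nonDegenerate := fun k a hk => h.nonDegenerate k a ((C.depOnlyOn_absorb_iff S hxor hclosed k a).mp hk)
    no_troubled_pair := h.no_troubled_pair
    protected_one_reader := h.protected_one_reader
    protected_not_and := h.protected_not_and
    protected_pos := h.protected_pos
    and_fanout_le := h.and_fanout_le
    no_and_one_var := h.no_and_one_var }

end Absorb

/-! ### Absorbing the strict ancestors of a topologically minimal ∧-type gate -/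

section AbsorbAnc

variable {C}
variable {G : Fin C.m} (hN : C.NonDegenerate) (hG : C.IsTopMinAnd G)

include hN hG in
/-- Strict ancestors of a topologically minimal ∧-type gate are ⊕-type (in a non-degenerate
circuit). [cite: LiYang2022, §2.6] -/
theorem isXorOp_of_mem_strictAncestors : ∀ k ∈ C.strictAncestors G, IsXorOp (C.op k) := fun k hk =>
  C.isXorOp_of_isAffineOp hN ((isAndOp_or_isAffineOp (C.op k)).resolve_left (hG.2 k hk))

/-- Strict ancestors are closed under predecessors. [folklore] -/
theorem strictAncestors_closed : ∀ k ∈ C.strictAncestors G, ∀ (a : Fin 2) (k' : Fin C.m),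
    C.arg k a = .gate k' → k' ∈ C.xorPart ∨ k' ∈ C.strictAncestors G :=
  fun k hk a k' h => Or.inr (C.isClosed_ancestors _ k hk a k' h)

/-- **The circuit with the strict ancestors of `G` absorbed into the xor-part.** [cite: LiYang2022, §2.6, §4.1] -/
abbrev absorbAnc : Semicircuit n :=
  C.absorb (C.strictAncestors G) (isXorOp_of_mem_strictAncestors hN hG) strictAncestors_closed

include hN hG in
/-- After absorption, `G` reads only variables, constants, and gates of the xor-part. [cite: LiYang2022, §2.6] -/
theorem arg_mem_xorPart_absorbAnc {a : Fin 2} {k : Fin C.m} (h : C.arg G a = .gate k) : k ∈ (absorbAnc hN hG).xorPart := by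
  refine mem_union_right _ (C.subset_ancestors _ ?_)
  unfold preds; rw [mem_filter]; exact ⟨mem_univ _, a, h⟩

include hN hG in
/-- After absorption, `G` is still in the acyclic part. [cite: LiYang2022, §2.6] -/
theorem not_mem_xorPart_absorbAnc : G ∉ (absorbAnc hN hG).xorPart := by
  intro h
  rcases mem_union.mp h with h | h
  · exact IsAndOp.not_isXorOp hG.1 (C.isXorOp_of_mem G h)
  · exact C.not_mem_strictAncestors_self (fun hK => IsAndOp.not_isXorOp hG.1 (C.isXorOp_of_mem G hK)) h

end AbsorbAnc

end Semicircuit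

end Literature.Computability.Complexity
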